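/-
Copyright: statement-level skeleton of a published paper (lit-balaban cell, Phase-2 proof seat p13, gen 6). No proof
claims beyond what the kernel checks below.
-/
import Literature.MathematicalPhysics.QuantumFieldTheory.BalabanImbrieJaffe1984to88.BIJ88Eq248Lattice

/-!
# `BalabanImbrieJaffe1984to88.BIJ88Locality246Lattice` — T. Bałaban, J. Imbrie, A. Jaffe, *Effective action and cluster
properties of the abelian Higgs model*, Commun. Math. Phys. **114** (1988) 257–315 [BalabanImbrieJaffe1988], §2
p. 264 [PDF 8]: **the `u`-LOCALITY CLAUSES of (2.43)/(2.46)** — *"The local part C^{(k)}_{Λ,loc}(u; x₁, x₂) depends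
only on u in an O(r(e_k)) neighborhood of x₁, x₂"* and *"The operator C^{(k)}_{Λ,X}(u) depends only on u in X"* —
PROVED FOR THE `ℤ^d` OPERATORS OF [6] = [Balaban1983RegularityDecay] Sect. 5 (the walk terms
`BIJ88Eq242Lattice.latticeCw`), as locality IN THE OPERATOR: the local part at `(x₁, x₂)` sees only the entries of
`A` within `(ρ + 1)M` of `x₁` and of `x₂`, the `X`-part sees only the entries of `A` on the sites of `X`.

statement-level skeleton of published theorems with citation tags; proofs where landed; nothing here is a claim
about the Yang–Mills mass gap

PDF held: `paper:balaban1988-cmp114-bij-abelian-higgs-effective-action` (journal page = PDF page + 256; p. 264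
read with `lit read … --pages 8`).

CITATION HEADER (lean-in-tree rule).  lit-balaban cell (HOME `run/shared/lean/pub/lit-balaban/`), Phase 2, seat p13
gen 6 (unit `lit-balaban-p13-g6`); rows **C2.Eq2.43** (clause «depends only on u in an O(r(e_k)) neighborhood of
x₁, x₂») and **C2.Eq2.46** (clause «depends on u only in X») of `HOME/lit-balaban-r18/ROWS-C2.md` (owner r18, referee
ref-5).  Files USED BY NAME, nothing restated: `…BIJ88RandomWalk242` (`Walk`, `Near`, `cLoc`, `cubesMet`, `region`,
`cX`, `subset_closure`), `…BIJ88Eq242Lattice` (`flatten`, `latticeCw`), `…BIJ88Ineq246Lattice` (p251520: `LTup`,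
`term`, `ldist`, `pt`, `pt_zero`/`pt_odd`/`pt_even_succ`, `mem_pts_flatten_iff`, `tsum_indicator_latticeCw_eq`,
`Cubes`, `cubeOf`, `touch`), `…BIJ88Eq248Lattice` (p252150: `compress_apply`, `dist_le_of_inBox`),
`…B4Sect5CubeBounds` (the cube system on `ℤ^d`: `labels`, `InBox`, `boxSet`/`mem_boxSet`/`boxSet_subset`, `hFam`,
`pFam`, `cFam`/`cOp`, entry formulas `rPair_diag_apply`, `rPair_offDiag_apply`, `boxInd_eq`, `inBox_of_hfun_ne_zero`),
`…B4Sect5RandomWalk` (`walkTerm517`, `aFac`, `bFac`, `rPair`), `…B4RandomWalk213` (`bprod`), `…B4` (`B4.compress`).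
The `u`-locality of the ENTRIES of the print's operator `Δ_{k,loc}(u) + aL^{−2}Q(u)*Q(u)` ((2.40)) is row C2.Eq2.34's
`BIJ88Close235Proof.deltaKer_congr_local` (p02 g3, p248026) — composed with this file it gives the printed clauses;
that composition is displayed in §5 with the locality range of `u ↦ A(u)` an explicit parameter `r₀`.

## The print (verbatim, p. 264)

*"… the convergence and locality properties of the random walk expansion imply the following facts about these
operators. The local part C^{(k)}_{Λ,loc}(u; x₁, x₂) depends only on u in an O(r(e_k)) neighborhood of x₁, x₂; it
vanishes for |x₁ − x₂| > ½r(e_k) and is bounded as in (2.41). The operator C^{(k)}_{Λ,X}(u) depends only on u in X. It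
vanishes unless both arguments are in X, and is estimated as follows: |C^{(k)}_{Λ,X}(u; x₁, x₂)| ≤ e^{−cr(e_k)|X|}.
(2.46)"*

## What is proved (termwise; ANY `A`, `A′`, any cube size `M ≥ 1`, any radius `ρ`; no (5.6), no convergence)

* §1 `AgreeOn S A A′`: two operators on `L²(Λ; ℝ^N)` with equal entries on `S × S` (`S` a set of sites).
* §2 the factors of the [6] (5.17) walk terms depend on `A` only through the entries of their boxes: `C_j =
  (A|_{□_j})^{−1}` through `□_j × □_j` (`cFam_congr`), `R_{j,j′}` through `(□_j ∪ □_{j′})²` (`rPair_congr`), hence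
  `h_jC_jh_j`, `R_{j,j′}C_{j′}h_{j′}` (`aFac_congr`, `bFac_congr`) and the whole walk term of a tuple through the boxes
  of its labels (`term_congr`).
* §3 **(2.43) clause** `cLoc_congr_local`: if `A`, `A′` agree on the sites within `(ρ + 1)M` (lattice sup-distance) of
  `x₁` AND of `x₂`, then `C_{Λ,loc}[A](x₁, x₂) = C_{Λ,loc}[A′](x₁, x₂)` — every primed walk stays within `ρ` (label
  units) of both points, so its boxes lie in that neighbourhood (`boxSet_subset_nbhd`).  In the print's letters
  `ρM = ¼r(e_k)`, so the neighbourhood is `¼r(e_k) + M ≤ ½r(e_k)`: the *"O(r(e_k)) neighborhood of x₁, x₂"*.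
* §4 **(2.46) clause** `cX_congr_local`: if `A`, `A′` agree on the sites of `X` (`sitesOf X` = the union of the boxes
  `□_l` over the labels `l` whose `r(e_k)`-cube belongs to `X`), then `C_{Λ,X}[A](x₁, x₂) = C_{Λ,X}[A′](x₁, x₂)` for
  all `x₁, x₂` — a walk of class `X` has all its cubes in `X` (`cubesMet ⊆ region = X`).
* §5 the printed form: for any parametrisation `u ↦ A(u)` whose entries on a site set `T` depend on `u` only within
  `r₀` of `T` (hypothesis displayed; for (2.40) this is (2.34)/(2.28): `BIJ88Close235Proof.deltaKer_congr_local`),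
  `C_{Λ,X}(u)` depends on `u` only within `r₀` of the sites of `X` (`cX_congr_fields`) and `C_{Λ,loc}(u; x₁, x₂)` only
  within `(ρ + 1)M + r₀` of `x₁, x₂` (`cLoc_congr_fields`).
HONEST SCOPE.  Operators of [6] Sect. 5 only (as in `BIJ88Eq242Lattice`); the identification of `A` with the print's
`Δ_{k,loc}(u) + aL^{−2}Q(u)*Q(u)` is not made here; "in X" is made the explicit site set `sitesOf X` (boxes `□_l` have
side `2M`, so `sitesOf X` exceeds the union of the `r(e_k)`-cubes of `X` by less than one `M`-layer — every site of it
lies in the box of a label whose cube is in `X`).  No `sorry`; no new `Prop` fact.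
-/

namespace Literature.MathematicalPhysics.QuantumFieldTheory.BalabanImbrieJaffe1984to88.BIJ88Locality246Lattice

open scoped BigOperators
open Finset
open Literature.MathematicalPhysics.QuantumFieldTheory.Balaban1983to89
open Literature.MathematicalPhysics.QuantumFieldTheory.BalabanImbrieJaffe1984to88
open B4RandomWalk213 B4Sect5RandomWalk B4Sect5CubeBounds B6GOmega BIJ88RandomWalk242 BIJ88Eq242Lattice
  BIJ88Ineq246Lattice BIJ88Eq248Lattice

open scoped Matrix

variable {d N : ℕ} {Λ : Finset (Fin d → ℤ)}

/-! ## §1 Two operators agreeing on a set of sites -/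

/-- `A` and `A′` on `L²(Λ; ℝ^N)` AGREE ON the site set `S`: equal entries `A(y, y′) = A′(y, y′)` for all sites
`y, y′ ∈ S` (all components).  The print's *"depends only on u in S"* for `A = A(u)`, `A′ = A(u′)` with `u = u′` on
`S`. [cite: BalabanImbrieJaffe1988, (2.46) p.264] -/
def AgreeOn (S : Finset (Fin d → ℤ)) (A A' : Matrix (B4.Idx Λ N) (B4.Idx Λ N) ℝ) : Prop :=
  ∀ p q : B4.Idx Λ N, (p.1 : Fin d → ℤ) ∈ S → (q.1 : Fin d → ℤ) ∈ S → A p q = A' p q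

namespace AgreeOn

variable {S T : Finset (Fin d → ℤ)} {A A' A'' : Matrix (B4.Idx Λ N) (B4.Idx Λ N) ℝ}

/-- agreement on a set passes to subsets. [cite: BalabanImbrieJaffe1988, (2.46) p.264] -/
theorem mono (hST : S ⊆ T) (h : AgreeOn T A A') : AgreeOn S A A' :=
  fun p q hp hq => h p q (hST hp) (hST hq)

/-- agreement is reflexive. [cite: BalabanImbrieJaffe1988, (2.46) p.264] -/
theorem refl (S : Finset (Fin d → ℤ)) (A : Matrix (B4.Idx Λ N) (B4.Idx Λ N) ℝ) : AgreeOn S A A :=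
  fun _ _ _ _ => rfl

/-- agreement is symmetric. [cite: BalabanImbrieJaffe1988, (2.46) p.264] -/
theorem symm (h : AgreeOn S A A') : AgreeOn S A' A :=
  fun p q hp hq => (h p q hp hq).symm

/-- agreement is transitive. [cite: BalabanImbrieJaffe1988, (2.46) p.264] -/
theorem trans (h : AgreeOn S A A') (h' : AgreeOn S A' A'') : AgreeOn S A A'' :=
  fun p q hp hq => (h p q hp hq).trans (h' p q hp hq)

/-- two operators agree on `S` iff their compressions to `S ∩ Λ`-indices coincide entrywise — here in the usable
direction: agreement on `Λ′ ⊆ Λ` gives equal Dirichlet compressions `A|_{Λ′} = A′|_{Λ′}` (`B4.compress`).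
[cite: Balaban1983RegularityDecay, Sect. 5 Theorem p.594 (A_Λ = ΛAΛ)] -/
theorem compress_eq {Λ' : Finset (Fin d → ℤ)} (hΛ' : Λ' ⊆ Λ) (h : AgreeOn Λ' A A') :
    B4.compress hΛ' A = B4.compress hΛ' A' := by
  ext p q
  rw [compress_apply, compress_apply]
  exact h _ _ p.1.2 q.1.2

end AgreeOn

/-! ## §2 The factors of [6] (5.17) depend on `A` only through the entries of their boxes -/

section Factors

variable {M : ℕ} {A A' : Matrix (B4.Idx Λ N) (B4.Idx Λ N) ℝ}

/-- `C_j = (A|_{□_j})^{−1}` (extended by zero) depends on `A` only through `□_j × □_j`. [cite: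
Balaban1983RegularityDecay, (5.12) p.594] -/
theorem cOp_congr {j : Fin d → ℤ} (h : AgreeOn (boxSet M Λ j) A A') : cOp M A j = cOp M A' j := by
  unfold cOp
  rw [h.compress_eq (boxSet_subset M Λ j)]

/-- the family `C_j`: `C_j[A] = C_j[A′]` when `A`, `A′` agree on `□_j`. [cite: Balaban1983RegularityDecay, (5.12) p.594] -/
theorem cFam_congr (j : ↥(labels M Λ)) (h : AgreeOn (boxSet M Λ j.1) A A') : cFam M A j = cFam M A' j :=
  cOp_congr h

/-- `R_{j,j′}` of (5.14) depends on `A` only through `(□_j ∪ □_{j′}) × (□_j ∪ □_{j′})`: `R_{j,j} = −□_j[A,h_j]□_j` is cut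
off to `□_j × □_j` by the two indicators, `R_{j,j′} = −(1−□_{j′})h_j²Ah_{j′}` (`j ≠ j′`) to `□_j × □_{j′}` by
`supp h_j ⊆ □_j`, `supp h_{j′} ⊆ □_{j′}`. [cite: Balaban1983RegularityDecay, (5.14) p.595] -/
theorem rPair_congr (hM : 0 < M) (j j' : ↥(labels M Λ)) (h : AgreeOn (boxSet M Λ j.1 ∪ boxSet M Λ j'.1) A A') :
    rPair A (pFam N M Λ) (hFam N M Λ) j j' = rPair A' (pFam N M Λ) (hFam N M Λ) j j' := by
  ext p q
  by_cases hjj : j = j'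
  · subst hjj
    rw [rPair_diag_apply, rPair_diag_apply, boxInd_eq, boxInd_eq]
    by_cases hp : InBox M j.1 (p.1 : Fin d → ℤ)
    · by_cases hq : InBox M j.1 (q.1 : Fin d → ℤ)
      · rw [h p q (Finset.mem_union_left _ (mem_boxSet.mpr ⟨p.1.2, hp⟩))
          (Finset.mem_union_left _ (mem_boxSet.mpr ⟨q.1.2, hq⟩))]
      · simp [hq]
    · simp [hp]
  · rw [rPair_offDiag_apply M A hjj, rPair_offDiag_apply M A' hjj]
    by_cases hp : hfun M j.1 (p.1 : Fin d → ℤ) = 0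
    · rw [hp]; ring
    · by_cases hq : hfun M j'.1 (q.1 : Fin d → ℤ) = 0
      · rw [hq]; ring
      · rw [h p q (Finset.mem_union_left _ (mem_boxSet.mpr ⟨p.1.2, inBox_of_hfun_ne_zero hM hp⟩))
          (Finset.mem_union_right _ (mem_boxSet.mpr ⟨q.1.2, inBox_of_hfun_ne_zero hM hq⟩))]

/-- the vertex factor `h_jC_jh_j` depends on `A` only through `□_j × □_j`. [cite: Balaban1983RegularityDecay, (5.17) p.595] -/
theorem aFac_congr (j : ↥(labels M Λ)) (h : AgreeOn (boxSet M Λ j.1) A A') :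
    aFac (hFam N M Λ) (cFam M A) j = aFac (hFam N M Λ) (cFam M A') j := by
  unfold aFac
  rw [cFam_congr j h]

/-- the pair factor `R_{l,l′}C_{l′}h_{l′}` depends on `A` only through `(□_l ∪ □_{l′})²`. [cite:
Balaban1983RegularityDecay, (5.17) p.595] -/
theorem bFac_congr (hM : 0 < M) (q : ↥(labels M Λ) × ↥(labels M Λ))
    (h : AgreeOn (boxSet M Λ q.1.1 ∪ boxSet M Λ q.2.1) A A') :
    bFac A (pFam N M Λ) (hFam N M Λ) (cFam M A) q = bFac A' (pFam N M Λ) (hFam N M Λ) (cFam M A') q := by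
  unfold bFac
  rw [rPair_congr hM q.1 q.2 h, cFam_congr q.2 (h.mono Finset.subset_union_right)]

/-- ordered products with termwise equal factors are equal (bookkeeping for the walk terms of (5.17)). [cite:
Balaban1983RegularityDecay, (5.17) p.595] -/
theorem bprod_congr_of_eq {R ι : Type*} [Ring R] {b b' : ι → R} :
    ∀ (n : ℕ) (ys : Fin n → ι), (∀ i, b (ys i) = b' (ys i)) → bprod b n ys = bprod b' n ys := by
  intro n
  induction n with
  | zero => intro ys _; rfl
  | succ n ih =>
      intro ys hys
      rw [bprod_succ, bprod_succ, hys 0, ih (Fin.tail ys) fun i => hys i.succ]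

/-- the first label of the `i`-th pair is visited by the flattened walk. [cite: Balaban1983RegularityDecay, (5.17) p.595] -/
theorem pair_fst_mem_pts (cc : LTup M Λ) (i : Fin cc.1) : (cc.2.2 i).1 ∈ (flatten cc).pts :=
  (mem_pts_flatten_iff cc _).mpr ⟨2 * i.val + 1, by omega, pt_odd cc i⟩

/-- the second label of the `i`-th pair is visited by the flattened walk. [cite: Balaban1983RegularityDecay, (5.17) p.595] -/
theorem pair_snd_mem_pts (cc : LTup M Λ) (i : Fin cc.1) : (cc.2.2 i).2 ∈ (flatten cc).pts :=
  (mem_pts_flatten_iff cc _).mpr ⟨2 * i.val + 2, by omega, pt_even_succ cc i⟩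

/-- the start label is visited by the flattened walk. [cite: Balaban1983RegularityDecay, (5.17) p.595] -/
theorem start_mem_pts' (cc : LTup M Λ) : cc.2.1 ∈ (flatten cc).pts :=
  (mem_pts_flatten_iff cc _).mpr ⟨0, Nat.zero_le _, pt_zero cc⟩

/-- **THE WALK TERM DEPENDS ON `A` ONLY THROUGH THE BOXES OF ITS LABELS**: if every box `□_l`, `l` a label of the
(flattened) tuple `cc`, lies in `S`, and `A`, `A′` agree on `S`, then the [6] (5.17) walk terms of `A` and `A′` for
`cc` coincide (as operators). [cite: Balaban1983RegularityDecay, (5.17) p.595; BalabanImbrieJaffe1988, (2.46) p.264] -/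
theorem term_congr (hM : 0 < M) (cc : LTup M Λ) {S : Finset (Fin d → ℤ)}
    (hS : ∀ l ∈ (flatten cc).pts, boxSet M Λ l.1 ⊆ S) (h : AgreeOn S A A') : term M A cc = term M A' cc := by
  unfold term walkTerm517
  rw [aFac_congr cc.2.1 (h.mono (hS _ (start_mem_pts' cc))),
    bprod_congr_of_eq cc.1 cc.2.2 fun i => bFac_congr hM (cc.2.2 i)
      (h.mono (Finset.union_subset (hS _ (pair_fst_mem_pts cc i)) (hS _ (pair_snd_mem_pts cc i))))]

end Factors

/-! ## §3 (2.43): the local part sees `A` only near `x₁, x₂` -/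

section Local

variable {M : ℕ} {A A' : Matrix (B4.Idx Λ N) (B4.Idx Λ N) ℝ}

/-- the sites of `Λ` within `(ρ + 1)M` (lattice sup-distance) of the site of `x` — the *"O(r(e_k)) neighborhood"* of
p. 264 for `ρM = ¼r(e_k)`. [cite: BalabanImbrieJaffe1988, (2.43) p.264] -/
noncomputable def nbhd (M : ℕ) (ρ : ℝ) (x : B4.Idx Λ N) : Finset (Fin d → ℤ) :=
  Λ.filter fun y => dist y (x.1 : Fin d → ℤ) ≤ (ρ + 1) * M

/-- membership in the neighbourhood. [cite: BalabanImbrieJaffe1988, (2.43) p.264] -/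
theorem mem_nbhd {ρ : ℝ} {x : B4.Idx Λ N} {y : Fin d → ℤ} :
    y ∈ nbhd M ρ x ↔ y ∈ Λ ∧ dist y (x.1 : Fin d → ℤ) ≤ (ρ + 1) * M := Finset.mem_filter

/-- the box of a label within `ρ` (label units) of `x` lies within `(ρ + 1)M` of `x`: `|y − Ml| ≤ M` on `□_l` and
`|Ml − x| ≤ ρM`. [cite: BalabanImbrieJaffe1988, (2.43) p.264; Balaban1983RegularityDecay, (5.11) p.594] -/
theorem boxSet_subset_nbhd (hM : 0 < M) {ρ : ℝ} {l : ↥(labels M Λ)} {x : B4.Idx Λ N}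
    (hl : ldist (N := N) M l x ≤ ρ) : boxSet M Λ l.1 ⊆ nbhd M ρ x := by
  intro y hy
  obtain ⟨hyΛ, hin⟩ := mem_boxSet.mp hy
  refine mem_nbhd.mpr ⟨hyΛ, ?_⟩
  have hMr : (0 : ℝ) < M := by exact_mod_cast hM
  have h1 : dist ((M : ℤ) • (l.1 : Fin d → ℤ)) (x.1 : Fin d → ℤ) ≤ ρ * M := by
    have := hl
    unfold ldist at this
    rwa [div_le_iff₀ hMr] at this
  have h2 : dist ((M : ℤ) • (l.1 : Fin d → ℤ)) y ≤ M := dist_le_of_inBox hin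
  have h3 := dist_triangle y ((M : ℤ) • (l.1 : Fin d → ℤ)) (x.1 : Fin d → ℤ)
  rw [dist_comm y ((M : ℤ) • (l.1 : Fin d → ℤ))] at h3
  linarith

/-- **(2.43), LOCALITY CLAUSE, FOR THE `ℤ^d` OPERATORS OF [6]** — *"The local part C^{(k)}_{Λ,loc}(u; x₁, x₂) depends
only on u in an O(r(e_k)) neighborhood of x₁, x₂"*: for finite `Λ ⊂ ℤ^d`, ANY two operators `A`, `A′` on `L²(Λ;
ℝ^N)`, cubes `M ≥ 1`, radius `ρ`: if `A` and `A′` have the same entries on the sites within `(ρ + 1)M` of `x₁` and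
within `(ρ + 1)M` of `x₂`, then their local parts (2.43) at `(x₁, x₂)` coincide — every primed walk stays within `ρ`
of both points, and its term uses only entries of `A` in the boxes of its labels. [cite: BalabanImbrieJaffe1988, (2.43) p.264] -/
theorem cLoc_congr_local (hM : 0 < M) (ρ : ℝ) (x₁ x₂ : B4.Idx Λ N)
    (h : AgreeOn (nbhd M ρ x₁ ∩ nbhd M ρ x₂) A A') :
    cLoc (ldist (N := N) M) ρ (fun ω y₁ y₂ => latticeCw M Λ N A ω y₁ y₂) x₁ x₂
      = cLoc (ldist (N := N) M) ρ (fun ω y₁ y₂ => latticeCw M Λ N A' ω y₁ y₂) x₁ x₂ := by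
  classical
  unfold cLoc
  rw [tsum_indicator_latticeCw_eq A _ x₁ x₂, tsum_indicator_latticeCw_eq A' _ x₁ x₂]
  refine tsum_congr fun cc => ?_
  by_cases hmem : cc ∈ flatten ⁻¹' {ω : Walk ↥(labels M Λ) | Near (ldist (N := N) M) ρ ω x₁ x₂}
  · rw [Set.indicator_of_mem hmem, Set.indicator_of_mem hmem]
    have hnear : Near (ldist (N := N) M) ρ (flatten cc) x₁ x₂ := hmem
    rw [term_congr hM cc (fun l hl => Finset.subset_inter (boxSet_subset_nbhd hM (hnear l hl).1)
      (boxSet_subset_nbhd hM (hnear l hl).2)) h]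
  · rw [Set.indicator_of_notMem hmem, Set.indicator_of_notMem hmem]

/-- the same for the Dirichlet operators of (2.39)/(2.40): if `A`, `A′` on `L²(Ω)` agree on the neighbourhood
(read in `Ω`), the local parts of `[A|_Λ]^{−1}` and `[A′|_Λ]^{−1}` at `(x₁, x₂)` coincide. [cite: BalabanImbrieJaffe1988,
(2.43) p.264, (2.39) p.264] -/
theorem cLoc_congr_local_compress (hM : 0 < M) {Ω : Finset (Fin d → ℤ)} (hΛ : Λ ⊆ Ω)
    {B B' : Matrix (B4.Idx Ω N) (B4.Idx Ω N) ℝ} (ρ : ℝ) (x₁ x₂ : B4.Idx Λ N)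
    (h : AgreeOn (N := N) (nbhd M ρ x₁ ∩ nbhd M ρ x₂) B B') :
    cLoc (ldist (N := N) M) ρ (fun ω y₁ y₂ => latticeCw M Λ N (B4.compress hΛ B) ω y₁ y₂) x₁ x₂
      = cLoc (ldist (N := N) M) ρ (fun ω y₁ y₂ => latticeCw M Λ N (B4.compress hΛ B') ω y₁ y₂) x₁ x₂ :=
  cLoc_congr_local hM ρ x₁ x₂ fun p q hp hq => by
    rw [compress_apply, compress_apply]
    exact h _ _ hp hq

end Local

/-! ## §4 (2.46): the `X`-part sees `A` only on the sites of `X` -/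

section XPart

variable {M s : ℕ} {A A' : Matrix (B4.Idx Λ N) (B4.Idx Λ N) ℝ}

/-- THE SITES OF A CUBE SET `X`: the union of the boxes `□_l` over the labels `l` whose `r(e_k)`-cube `cubeOf l`
belongs to `X` (the print's *"u in X"* made a set of lattice sites). [cite: BalabanImbrieJaffe1988, (2.46) p.264] -/
noncomputable def sitesOf (M s : ℕ) (X : Finset (Cubes (d := d) M s Λ)) : Finset (Fin d → ℤ) :=
  (Finset.univ.filter fun l : ↥(labels M Λ) => cubeOf M s l ∈ X).biUnion fun l => boxSet M Λ l.1

/-- the box of a label of a cube of `X` lies in the sites of `X`. [cite: BalabanImbrieJaffe1988, (2.46) p.264] -/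
theorem boxSet_subset_sitesOf {X : Finset (Cubes (d := d) M s Λ)} {l : ↥(labels M Λ)} (hl : cubeOf M s l ∈ X) :
    boxSet M Λ l.1 ⊆ sitesOf M s X := by
  classical
  intro y hy
  exact Finset.mem_biUnion.mpr ⟨l, Finset.mem_filter.mpr ⟨Finset.mem_univ _, hl⟩, hy⟩

/-- the sites of `X` are sites of `Λ`. [cite: BalabanImbrieJaffe1988, (2.46) p.264] -/
theorem sitesOf_subset (X : Finset (Cubes (d := d) M s Λ)) : sitesOf M s X ⊆ Λ := by
  classical
  intro y hy
  obtain ⟨l, -, hl⟩ := Finset.mem_biUnion.mp hy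
  exact boxSet_subset M Λ l.1 hl

/-- the sites are monotone in the cube set. [cite: BalabanImbrieJaffe1988, (2.46) p.264] -/
theorem sitesOf_mono {X Y : Finset (Cubes (d := d) M s Λ)} (hXY : X ⊆ Y) : sitesOf M s X ⊆ sitesOf M s Y := by
  classical
  intro y hy
  obtain ⟨l, hl, hy⟩ := Finset.mem_biUnion.mp hy
  exact Finset.mem_biUnion.mpr
    ⟨l, Finset.mem_filter.mpr ⟨Finset.mem_univ _, hXY (Finset.mem_filter.mp hl).2⟩, hy⟩

/-- a walk whose cube region is `X` meets only cubes of `X` (`X⁰(ω) ⊆ X(ω)`). [cite: BalabanImbrieJaffe1988, (2.44) p.264] -/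
theorem cubeOf_mem_of_region_eq {X : Finset (Cubes (d := d) M s Λ)} {ω : Walk ↥(labels M Λ)}
    (hω : region (cubeOf M s) touch ω = X) {l : ↥(labels M Λ)} (hl : l ∈ ω.pts) : cubeOf M s l ∈ X := by
  classical
  rw [← hω]
  exact subset_closure _ _ (Finset.mem_image_of_mem _ hl)

/-- **(2.46), LOCALITY CLAUSE, FOR THE `ℤ^d` OPERATORS OF [6]** — *"The operator C^{(k)}_{Λ,X}(u) depends only on u
in X"*: for finite `Λ ⊂ ℤ^d`, ANY two operators `A`, `A′` on `L²(Λ; ℝ^N)`, cubes `M ≥ 1` grouped in `r(e_k)`-cubes of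
`s` labels, radius `ρ`, and any cube set `X`: if `A` and `A′` have the same entries on the sites of `X` (`sitesOf X`),
then `C_{Λ,X}[A](x₁, x₂) = C_{Λ,X}[A′](x₁, x₂)` for all `x₁, x₂` — a walk of class `X` has all its cubes in `X`, and its
term uses only entries of `A` in the boxes of its labels. [cite: BalabanImbrieJaffe1988, (2.46) p.264] -/
theorem cX_congr_local (hM : 0 < M) (ρ : ℝ) (X : Finset (Cubes (d := d) M s Λ)) (x₁ x₂ : B4.Idx Λ N)
    (h : AgreeOn (sitesOf M s X) A A') :
    cX (ldist (N := N) M) ρ (cubeOf M s) touch (fun ω y₁ y₂ => latticeCw M Λ N A ω y₁ y₂) X x₁ x₂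
      = cX (ldist (N := N) M) ρ (cubeOf M s) touch (fun ω y₁ y₂ => latticeCw M Λ N A' ω y₁ y₂) X x₁ x₂ := by
  classical
  unfold cX
  rw [tsum_indicator_latticeCw_eq A _ x₁ x₂, tsum_indicator_latticeCw_eq A' _ x₁ x₂]
  refine tsum_congr fun cc => ?_
  by_cases hmem : cc ∈ flatten ⁻¹'
      {ω : Walk ↥(labels M Λ) | ¬ Near (ldist (N := N) M) ρ ω x₁ x₂ ∧ region (cubeOf M s) touch ω = X}
  · rw [Set.indicator_of_mem hmem, Set.indicator_of_mem hmem]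
    have hreg : region (cubeOf M s) touch (flatten cc) = X := hmem.2
    rw [term_congr hM cc (fun l hl => boxSet_subset_sitesOf (cubeOf_mem_of_region_eq hreg hl)) h]
  · rw [Set.indicator_of_notMem hmem, Set.indicator_of_notMem hmem]

/-- the same for the Dirichlet operators of (2.39)/(2.40): if `A`, `A′` on `L²(Ω)` agree on the sites of `X` (read in
`Ω`), the `X`-parts of `[A|_Λ]^{−1}` and `[A′|_Λ]^{−1}` coincide. [cite: BalabanImbrieJaffe1988, (2.46) p.264, (2.39) p.264] -/
theorem cX_congr_local_compress (hM : 0 < M) {Ω : Finset (Fin d → ℤ)} (hΛ : Λ ⊆ Ω)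
    {B B' : Matrix (B4.Idx Ω N) (B4.Idx Ω N) ℝ} (ρ : ℝ) (X : Finset (Cubes (d := d) M s Λ)) (x₁ x₂ : B4.Idx Λ N)
    (h : AgreeOn (N := N) (sitesOf M s X) B B') :
    cX (ldist (N := N) M) ρ (cubeOf M s) touch (fun ω y₁ y₂ => latticeCw M Λ N (B4.compress hΛ B) ω y₁ y₂) X x₁ x₂
      = cX (ldist (N := N) M) ρ (cubeOf M s) touch
          (fun ω y₁ y₂ => latticeCw M Λ N (B4.compress hΛ B') ω y₁ y₂) X x₁ x₂ :=
  cX_congr_local hM ρ X x₁ x₂ fun p q hp hq => by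
    rw [compress_apply, compress_apply]
    exact h _ _ hp hq

end XPart

/-! ## §5 The printed form: dependence on the background `u` through a local parametrisation `u ↦ A(u)` -/

section Fields

variable {M s : ℕ} {𝓤 : Type*}

/-- the `r₀`-neighbourhood (in `ℤ^d`, lattice sup-distance) of a set of sites. [cite: BalabanImbrieJaffe1988, p.264
("O(r(e_k))-neighborhood")] -/
def thicken (r₀ : ℝ) (T : Finset (Fin d → ℤ)) : Set (Fin d → ℤ) := {z | ∃ y ∈ T, dist z y ≤ r₀}

/-- thickening is monotone in the set. [cite: BalabanImbrieJaffe1988, p.264 ("O(r(e_k))-neighborhood")] -/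
theorem thicken_mono (r₀ : ℝ) {T T' : Finset (Fin d → ℤ)} (h : T ⊆ T') : thicken r₀ T ⊆ thicken r₀ T' :=
  fun _ ⟨y, hy, hzy⟩ => ⟨y, h hy, hzy⟩

/-- **(2.46), LOCALITY CLAUSE, PRINTED FORM** — *"The operator C^{(k)}_{Λ,X}(u) depends only on u in X"*: let
`u ↦ A(u)` be any parametrisation of operators on `L²(Λ; ℝ^N)` by backgrounds `u : 𝓤`, with an agreement relation
`same V u u′` ("`u = u′` on the set `V ⊆ ℤ^d`") and a locality range `r₀`: backgrounds agreeing on the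
`r₀`-neighbourhood of a site set `T` give operators agreeing on `T` (hypothesis `hloc`; for the print's
`Δ_{k,loc}(u) + aL^{−2}Q(u)*Q(u)` this is p. 264 *"Δ_{k,loc}(u; x₁, x₂) depends on u only in an O(r(e_k))-neighborhood of
x₁, x₂"*, `BIJ88Close235Proof.deltaKer_congr_local`).  Then `C_{Λ,X}(u) = C_{Λ,X}(u′)` whenever `u = u′` on the
`r₀`-neighbourhood of the sites of `X`. [cite: BalabanImbrieJaffe1988, (2.46) p.264] -/
theorem cX_congr_fields (hM : 0 < M) (Aof : 𝓤 → Matrix (B4.Idx Λ N) (B4.Idx Λ N) ℝ)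
    (same : Set (Fin d → ℤ) → 𝓤 → 𝓤 → Prop) (r₀ : ℝ)
    (hloc : ∀ (T : Finset (Fin d → ℤ)) (u u' : 𝓤), same (thicken r₀ T) u u' → AgreeOn T (Aof u) (Aof u'))
    (ρ : ℝ) (X : Finset (Cubes (d := d) M s Λ)) (x₁ x₂ : B4.Idx Λ N) {u u' : 𝓤}
    (huu' : same (thicken r₀ (sitesOf M s X)) u u') :
    cX (ldist (N := N) M) ρ (cubeOf M s) touch (fun ω y₁ y₂ => latticeCw M Λ N (Aof u) ω y₁ y₂) X x₁ x₂
      = cX (ldist (N := N) M) ρ (cubeOf M s) touch (fun ω y₁ y₂ => latticeCw M Λ N (Aof u') ω y₁ y₂) X x₁ x₂ :=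
  cX_congr_local hM ρ X x₁ x₂ (hloc _ u u' huu')

/-- **(2.43), LOCALITY CLAUSE, PRINTED FORM** — *"The local part C^{(k)}_{Λ,loc}(u; x₁, x₂) depends only on u in an
O(r(e_k)) neighborhood of x₁, x₂"*: with `u ↦ A(u)`, `same`, `r₀`, `hloc` as in `cX_congr_fields`,
`C_{Λ,loc}(u; x₁, x₂) = C_{Λ,loc}(u′; x₁, x₂)` whenever `u = u′` on the `r₀`-neighbourhood of the sites within
`(ρ + 1)M` of `x₁` and of `x₂` (print: `ρM = ¼r(e_k)`, `r₀ = O(r(e_k))`). [cite: BalabanImbrieJaffe1988, (2.43) p.264] -/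
theorem cLoc_congr_fields (hM : 0 < M) (Aof : 𝓤 → Matrix (B4.Idx Λ N) (B4.Idx Λ N) ℝ)
    (same : Set (Fin d → ℤ) → 𝓤 → 𝓤 → Prop) (r₀ : ℝ)
    (hloc : ∀ (T : Finset (Fin d → ℤ)) (u u' : 𝓤), same (thicken r₀ T) u u' → AgreeOn T (Aof u) (Aof u'))
    (ρ : ℝ) (x₁ x₂ : B4.Idx Λ N) {u u' : 𝓤} (huu' : same (thicken r₀ (nbhd M ρ x₁ ∩ nbhd M ρ x₂)) u u') :
    cLoc (ldist (N := N) M) ρ (fun ω y₁ y₂ => latticeCw M Λ N (Aof u) ω y₁ y₂) x₁ x₂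
      = cLoc (ldist (N := N) M) ρ (fun ω y₁ y₂ => latticeCw M Λ N (Aof u') ω y₁ y₂) x₁ x₂ :=
  cLoc_congr_local hM ρ x₁ x₂ (hloc _ u u' huu')

end Fields

end Literature.MathematicalPhysics.QuantumFieldTheory.BalabanImbrieJaffe1984to88.BIJ88Locality246Lattice
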